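import Literature.Geometry.Lorentzian.PositiveMassSchoenYau
import Literature.Geometry.Lorentzian.PositiveMassConformal
import Literature.Geometry.Lorentzian.DecaySymbols
import Literature.Geometry.Lorentzian.AsymptoticallyFlatCompleteness
import Literature.Geometry.Lorentzian.ChartCalculus
import Literature.Geometry.Lorentzian.IsometryProofs
import HarnessLib

/-!
# Step 1 of Schoen–Yau's proof from its two ingredients

This file proves that the named fact
`Literature.Geometry.Lorentzian.exists_conformal_scalarPos_of_massNeg` (Schoen–Yau, Comm. Math.
Phys. 65 (1979), §2 Step 1, vendored in `PositiveMassSchoenYau.lean`) follows from the two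
ingredients displayed in its printed proof (p. 49) — the conformal transformation law of scalar
curvature in dimension three, *"The well-known formula for the scalar curvature `R̃` is
`R̃ = φ⁻⁵(-8Δφ + Rφ)`"* (Aubin 1982, Ch. 6, §6.3, eq. (1) with `n = 3`), and the superharmonic
conformal factor (2.1)–(2.3) (`Δ(1/r) = M r⁻⁴ + O(r⁻⁵) < 0` for `r ≥ σ`; `φ = 1 + ζ(-M/4r)`,
`Δφ ≤ 0` on `N`, `Δφ < 0` and `φ = 1 - M/4r` for `r > 2σ`) — taken as the two *hypotheses* of
`exists_conformal_scalarPos_of_massNeg_of_ingredients` (written out there; they are classical but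
not in the tree, and are not vendored as named facts). What is proved here is the bookkeeping the
printed proof leaves implicit (p. 49: "The metric `d̃s²` is asymptotically flat since … on `N_k`
we have `d̃s² = (1 - M/4r)⁴ ds²` for `r ≥ 2σ`. Thus the new mass of `N_k` is `M̃ = M/2 < 0`"):

* `IsAsymptoticallySchwarzschild.conformal_of_eq_far` — **the expansion (1.1) of the conformal
  metric**: if `h = (1 + M/2r)⁴ δ + O₂(r⁻²)` on the end `e` and `φ` is a smooth positive function
  with `φ = 1 - M/4r` beyond some radius in the chart, then `φ⁴ h = (1 + M/4r)⁴ δ + O₂(r⁻²)`,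
  i.e. the conformal data `D.conformal φ` (`PositiveMassConformal.lean`) are asymptotically
  Schwarzschildean of mass `M/2` to second order. This is the chart computation
  `isBigOSmooth_conformalFourth_chart` of `DecaySymbols.lean` (`ψ⁴ H = (1 + (M+2A)/2r)⁴ c +
  O₂(r⁻²)` for `ψ = 1 + A/r`, here `A = -M/4`), transported to the conformal data by
  `AFEnd.hCoeff_conformal` and the locality of smooth symbols (`IsBigOSmooth.congr_far`).
* `exists_conformal_scalarPos_of_massNeg_of_ingredients` — Step 1 from its two ingredients,
  taken as hypotheses: the transformation law (for the prelude's `scalarCurvature` and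
  Laplace–Beltrami operator `dalembertian = tr Hess` of two smooth metrics `g' = φ⁴ g` on a
  `3`-manifold) and the superharmonic factor (a smooth positive `φ` — the printed `C⁵` profile
  `ζ` may be taken `C^∞` — with `Δφ ≤ 0` on `X`, `Δφ < 0` on a far region and `φ = 1 - M/4r`
  beyond it in the chart). With such `φ` the data `D.conformal φ` have `R' = φ⁻⁵(Rφ - 8Δφ) ≥ 0`,
  `> 0` far out, and mass `M/2 < 0`.
* `positive_mass_rigidity_of_steps'` — following the review of `PositiveMassSchoenYau.lean`: the
  rigidity DAG over Step 1, Steps 2–3, Cor. 3.1, the Ricci variation and Greene–Wu's Thm. A, with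
  the completeness leaf discharged (`isComplete_of_isSoleEnd_holds`, through
  `positive_mass_rigidity_of_source_facts''''`). Steps 2–3 of the proof of Thm. 1 (pp. 49–63)
  are not a named fact of the tree (a slice of the printed proof of Thm. 1, of the size of the
  theorem itself, reviewed under D-0026): they enter as the written-out hypothesis `h₂₃`, exactly
  as in `schoenYau_mass_nonneg_of_steps`.

## References

* R. Schoen, S.-T. Yau, *On the proof of the positive mass conjecture in general relativity*,
  Comm. Math. Phys. 65 (1979) 45–76, §1 (1.1), §2 Step 1 (pp. 48–49, (2.1)–(2.3)).
* T. Aubin, *Nonlinear analysis on manifolds. Monge–Ampère equations*, Grundlehren 252, Springer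
  1982, Ch. 6, §6.3, eq. (1) (the conformal transformation law; key `Aubin1982`).
* R. Bartnik, *The mass of an asymptotically flat manifold*, CPAM 39 (1986), §1 (1.3) (chart
  components of the metric).
-/

noncomputable section

open Bundle Set Manifold TopologicalSpace Filter Asymptotics Bornology Module
open scoped ContDiff Topology Manifold

namespace Literature.Geometry.Lorentzian

variable {X : Type} [TopologicalSpace X] [ChartedSpace E3 X] [IsManifold (𝓡 3) ∞ X]

/-! ### The expansion of the conformal metric -/

section Expansion

variable {e : AFEnd X} {D : InitialDataSet (𝓡 3) X}

/-- **The expansion (1.1) of the conformal metric.** If `h = (1 + M/2r)⁴ δ + O₂(r⁻²)` in the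
chart of the end `e` (`IsAsymptoticallySchwarzschild e D M 2`) and the smooth positive function
`φ` equals `1 - M/(4r)` in the chart beyond some radius `ρ ≥ e.R`, then the conformal data
`(φ⁴ h, k)` satisfy `φ⁴ h = (1 + M/4r)⁴ δ + O₂(r⁻²)`, i.e. they are asymptotically Schwarzschildean
of mass `M/2` to second order — Schoen–Yau 1979, p. 49: *"on `N_k` we have
`d̃s² = (1 - M/4r)⁴ ds²` for `r ≥ 2σ`. Thus the new mass of `N_k` is `M̃ = M/2`"*. Proof: the
chart computation `isBigOSmooth_conformalFourth_chart` with `H = hCoeff e D` (smooth on the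
exterior region, `AFEnd.ContDiffOn_hCoeff_holds` of `AsymptoticFlatnessProofs.lean`),
`ψ = 1 + A/r`, `A = -M/4` (so `M + 2A = M/2`), and the locality of smooth symbols
(`IsBigOSmooth.congr_far`: beyond `ρ` the conformal components are `ψ⁴ H`,
`AFEnd.hCoeff_conformal`). [cite: SchoenYauPMT1979, §2 Step 1 (p. 49)] -/
theorem IsAsymptoticallySchwarzschild.conformal_of_eq_far {M ρ : ℝ}
    (hAS : IsAsymptoticallySchwarzschild e D M 2) {φ : X → ℝ}
    (hφ : ContMDiff (𝓡 3) 𝓘(ℝ) ∞ φ) (hpos : ∀ x, 0 < φ x) (hρ : e.R ≤ ρ)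
    (hchart : ∀ y : exteriorRegion e.R, ρ < ‖(y : E3)‖ →
      φ (e.dataChart y) = 1 - M / (4 * ‖(y : E3)‖)) :
    IsAsymptoticallySchwarzschild e (D.conformal φ hφ hpos) (M / 2) 2 := by
  intro m hm
  -- the inputs of the chart computation: `H = hCoeff e D` and `ψ = 1 + A/r`, `A = -M/4`
  have hH : ContDiffOn ℝ ∞ (AFEnd.hCoeff e D) {y | e.R < ‖y‖} :=
    AFEnd.ContDiffOn_hCoeff_holds e D
  have hψ : ContDiffOn ℝ ∞ (fun y : E3 ↦ 1 + -(M / 4) / ‖y‖) {y | e.R < ‖y‖} := by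
    have hn : ContDiffOn ℝ ∞ (fun y : E3 ↦ ‖y‖) {y | e.R < ‖y‖} := fun y hy ↦
      (contDiffAt_norm ℝ (norm_pos_iff.1 (e.R_pos.trans hy))).contDiffWithinAt
    exact contDiffOn_const.add (contDiffOn_const.div hn fun y hy ↦ (e.R_pos.trans hy).ne')
  have hε : ∀ m : ℕ, m ≤ 2 →
      (fun x ↦ ‖iteratedFDeriv ℝ m
        (fun y : E3 ↦ (1 + -(M / 4) / ‖y‖) - (1 + -(M / 4) / ‖y‖)) x‖) =O[cobounded E3]
        fun x ↦ ‖x‖ ^ (-2 - m : ℝ) := by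
    intro m _
    have h0 : (fun y : E3 ↦ (1 + -(M / 4) / ‖y‖) - (1 + -(M / 4) / ‖y‖)) = fun _ ↦ (0 : ℝ) :=
      funext fun y ↦ sub_self _
    rw [h0]
    refine (isBigO_zero _ _).congr_left fun x ↦ ?_
    rw [iteratedFDeriv_fun_zero, Pi.zero_apply, norm_zero]
  have key := isBigOSmooth_conformalFourth_chart (c := (innerSL ℝ : E3 →L[ℝ] E3 →L[ℝ] ℝ))
    (A := -(M / 4)) hH hψ hAS hε
  -- beyond `ρ` the symbol of the chart computation is the deviation of the conformal data
  have hfg : ∀ y : E3, ρ < ‖y‖ →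
      (1 + -(M / 4) / ‖y‖) ^ 4 • AFEnd.hCoeff e D y -
          (1 + (M + 2 * -(M / 4)) / (2 * ‖y‖)) ^ 4 • (innerSL ℝ : E3 →L[ℝ] E3 →L[ℝ] ℝ) =
        AFEnd.hCoeff e (D.conformal φ hφ hpos) y -
          (1 + M / 2 / (2 * ‖y‖)) ^ 4 • (innerSL ℝ : E3 →L[ℝ] E3 →L[ℝ] ℝ) := by
    intro y hy
    have hyR : e.R < ‖y‖ := lt_of_le_of_lt hρ hy
    rw [AFEnd.hCoeff_conformal e D φ hφ hpos hyR, hchart ⟨y, hyR⟩ hy]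
    have e1 : (1 + -(M / 4) / ‖y‖) ^ 4 = (1 - M / (4 * ‖y‖)) ^ 4 := by ring
    have e2 : (1 + (M + 2 * -(M / 4)) / (2 * ‖y‖)) ^ 4 = (1 + M / 2 / (2 * ‖y‖)) ^ 4 := by ring
    rw [e1, e2]
  have hres : IsBigOSmooth 2 (-2) fun y : E3 ↦
      (AFEnd.hCoeff e (D.conformal φ hφ hpos) y -
          (1 + M / 2 / (2 * ‖y‖)) ^ 4 • (innerSL ℝ : E3 →L[ℝ] E3 →L[ℝ] ℝ) :
        E3 →L[ℝ] E3 →L[ℝ] ℝ) :=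
    key.congr_far hfg
  exact hres.isBigO hm

end Expansion

/-! ### Step 1 from its two ingredients -/

/-- **Schoen–Yau's Step 1 from the conformal transformation law and the superharmonic factor.**
The two ingredients displayed in the printed proof of Step 1 (Schoen–Yau 1979, p. 49) are taken
as hypotheses, written out (they are classical but not in the tree):
`hconf` — *the conformal transformation law of scalar curvature in dimension three*: for smooth
metrics `g` (Riemannian) and `g'` on the tangent bundle of a `3`-manifold modelled on `E3`, each
with its Levi-Civita connection, and a smooth positive `φ` with `g' = φ⁴ g` pointwise,
`R(g') = φ⁻⁵ (R(g) φ - 8 Δ_g φ)` with `Δ_g = tr_g Hess` the Laplace–Beltrami operator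
(`PseudoRiemannianMetric.dalembertian`) — p. 49: *"The well-known formula for the scalar
curvature `R̃` is `R̃ = φ⁻⁵(-8Δφ + Rφ)`"*; Aubin 1982, Ch. 6, §6.3, eq. (1):
`4((n-1)/(n-2)) Δφ + Rφ = R' φ^{(n+2)/(n-2)}` for `g' = φ^{4/(n-2)} g`, with Aubin's
`Δ = -∇^ν∇_ν`, at `n = 3`;
`hfac` — *the superharmonic conformal factor* (2.1)–(2.3): on an end with (1.1) and `M < 0`,
`Δ(1/r) = M r⁻⁴ + O(r⁻⁵) < 0` for `r ≥ σ` ((2.1)); `φ = 1 + ζ(-M/4r)` on the end, constant off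
it, with a concave nondecreasing profile `ζ` (printed `C⁵`; it may be taken `C^∞`), linear below
`t₀ = -M/8σ` and constant above `2t₀` ((2.2)), is a smooth positive function with `Δφ ≤ 0` on
`N` and `Δφ < 0` for `r > 2σ` ((2.3)), where also `φ = 1 - M/4r`; here for the end `e` of data
`D`: a smooth positive `φ` on `X` and a radius `ρ ≥ e.R` with `Δ_h φ ≤ 0` on `X`, `Δ_h φ < 0`
on `e.far ρ`, and `φ(Φ y) = 1 - M/(4‖y‖)` for `‖y‖ > ρ` (`Φ = e.dataChart`).
Proof, as printed: with `φ`, `ρ` from `hfac`, the conformal data `D' = (φ⁴ h, k)`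
(`InitialDataSet.conformal`, Levi-Civita connection `PseudoRiemannianMetric.hasLeviCivita`) have
`R' = φ⁻⁵ (R φ - 8 Δφ)` by `hconf`, hence `R' ≥ 0` on `X` and `R' > 0` on `e.far ρ`, and they
are asymptotically Schwarzschildean of mass `M/2 < 0`
(`IsAsymptoticallySchwarzschild.conformal_of_eq_far`).
[cite: SchoenYauPMT1979, §2 Step 1 (pp. 48–49)] -/
theorem exists_conformal_scalarPos_of_massNeg_of_ingredients
    (hconf : ∀ (X : Type) [TopologicalSpace X] [ChartedSpace E3 X] [IsManifold (𝓡 3) ∞ X]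
      (g g' : PseudoRiemannianMetric (𝓡 3) ∞ E3 (TangentSpace (𝓡 3) : X → Type _))
      [g.HasLeviCivita] [g'.HasLeviCivita] (φ : X → ℝ),
      g.IsRiemannian → ContMDiff (𝓡 3) 𝓘(ℝ) ∞ φ → (∀ x : X, 0 < φ x) →
      (∀ (x : X) (v w : TangentSpace (𝓡 3) x), g'.val x v w = φ x ^ 4 * g.val x v w) →
      ∀ x : X, g'.scalarCurvature x =
        (φ x ^ 5)⁻¹ * (g.scalarCurvature x * φ x - 8 * g.dalembertian φ x))
    (hfac : ∀ (X : Type) [TopologicalSpace X] [ChartedSpace E3 X] [IsManifold (𝓡 3) ∞ X]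
      [T2Space X] [SecondCountableTopology X] [ConnectedSpace X]
      (D : InitialDataSet (𝓡 3) X) [D.metric.HasLeviCivita] (e : AFEnd X) (M : ℝ),
      IsAsymptoticallySchwarzschild e D M 2 → M < 0 →
      ∃ (φ : X → ℝ) (ρ : ℝ), e.R ≤ ρ ∧ ContMDiff (𝓡 3) 𝓘(ℝ) ∞ φ ∧ (∀ x : X, 0 < φ x) ∧
        (∀ x : X, D.metric.dalembertian φ x ≤ 0) ∧
        (∀ x ∈ e.far ρ, D.metric.dalembertian φ x < 0) ∧
        ∀ y : exteriorRegion e.R, ρ < ‖(y : E3)‖ →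
          φ (e.dataChart y) = 1 - M / (4 * ‖(y : E3)‖)) :
    exists_conformal_scalarPos_of_massNeg := by
  intro X _ _ _ _ _ _ D _ e M _hor hAS _hsole hR hM
  obtain ⟨φ, ρ, hρ, hφ, hpos, hΔ, hΔfar, hchart⟩ := hfac X D e M hAS hM
  haveI hL : (D.conformal φ hφ hpos).metric.HasLeviCivita :=
    (D.conformal φ hφ hpos).metric.hasLeviCivita
  have hR' : ∀ x : X, (D.conformal φ hφ hpos).metric.scalarCurvature x =
      (φ x ^ 5)⁻¹ * (D.metric.scalarCurvature x * φ x - 8 * D.metric.dalembertian φ x) :=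
    hconf X D.metric (D.conformal φ hφ hpos).metric φ D.isRiemannian_metric hφ hpos
      (fun x v w ↦ rfl)
  refine ⟨φ, D.conformal φ hφ hpos, hL, M / 2, ρ, hpos, fun x v w ↦ rfl,
    hAS.conformal_of_eq_far hφ hpos hρ hchart, by linarith, fun x ↦ ?_, fun x hx ↦ ?_⟩
  · rw [hR' x]
    have h1 : 0 ≤ D.metric.scalarCurvature x * φ x := mul_nonneg (hR x) (hpos x).le
    have h2 : D.metric.dalembertian φ x ≤ 0 := hΔ x
    have h3 : 0 < (φ x ^ 5)⁻¹ := inv_pos.2 (pow_pos (hpos x) 5)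
    exact mul_nonneg h3.le (by linarith)
  · rw [hR' x]
    have h1 : 0 ≤ D.metric.scalarCurvature x * φ x := mul_nonneg (hR x) (hpos x).le
    have h2 : D.metric.dalembertian φ x < 0 := hΔfar x hx
    have h3 : 0 < (φ x ^ 5)⁻¹ := inv_pos.2 (pow_pos (hpos x) 5)
    exact mul_pos h3 (by linarith)

/-! ### The rigidity DAG without the completeness leaf -/

/-- **The rigidity DAG with Theorem 1 unfolded into its steps and completeness discharged**
(the variant of `positive_mass_rigidity_of_steps` asked for in its review):
`positive_mass_rigidity` (Schoen–Yau 1979, Thm. 2) follows from Step 1 and Steps 2–3 of the proof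
of Thm. 1, Cor. 3.1, the Ricci variation (3.24)–(3.30) and Greene–Wu's Thm. A, the completeness
of one-ended asymptotically flat data being `isComplete_of_isSoleEnd_holds`
(`positive_mass_rigidity_of_source_facts''''` with `schoenYau_mass_nonneg_of_steps`). Steps 2–3
(Schoen–Yau 1979, §2, pp. 49–63: with `R ≥ 0` on `N`, `R > 0` outside a compact subset of the
end and the expansion (1.1), the mass is not negative — complete area-minimising surface,
stability, Gauss–Bonnet) are the written-out hypothesis `h₂₃`, as in
`schoenYau_mass_nonneg_of_steps`; they are a slice of the printed proof of Thm. 1, not a named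
fact. [cite: SchoenYauPMT1979, Thms. 1–2 (p. 48), §2 and §3] -/
theorem positive_mass_rigidity_of_steps' (h₁ : exists_conformal_scalarPos_of_massNeg)
    (h₂₃ : ∀ (X : Type) [TopologicalSpace X] [ChartedSpace E3 X] [IsManifold (𝓡 3) ∞ X]
      [T2Space X] [SecondCountableTopology X] [ConnectedSpace X]
      (D : InitialDataSet (𝓡 3) X) [D.metric.HasLeviCivita] (e : AFEnd X) (M : ℝ),
      Literature.Topology.FourManifolds.IsOrientable (𝓡 3) X →
      IsAsymptoticallySchwarzschild e D M 2 → e.IsSoleEnd →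
      (∀ x : X, 0 ≤ D.metric.scalarCurvature x) →
      (∃ ρ : ℝ, ∀ x ∈ e.far ρ, 0 < D.metric.scalarCurvature x) → 0 ≤ M)
    (hc : exists_conformal_negativeMass_of_massZero)
    (hv : exists_ricciVariation_negativeMass_of_massZero)
    (h₅ : euclidean_of_isFlat_of_isSoleEnd) : positive_mass_rigidity :=
  positive_mass_rigidity_of_source_facts'''' (schoenYau_mass_nonneg_of_steps h₁ h₂₃) hc hv h₅

end Literature.Geometry.Lorentzian

end
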